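import Summits.Langlands.Langlands.Statement
import Literature.NumberTheory.Automorphic.IsAutomorphicAE
import HarnessLib

/-!
# On-path lemma (F4) for the rung `NonsolvableBaseChangeGL3 = NonsolvableBaseChangeRank 3` of line
# `NonsolvableBaseChangeGL3` (crux `ReciprocityUpToIrreducibility`, item stmt-Langlands-14328; g20)

`Langlands → NonsolvableBaseChangeRank n` for EVERY rank `n ≥ 1` (in particular the rung `n = 3` and every higher
rung): clause (B) of the summit over the TOP field `F` at any reciprocity datum — one exists by the `Nonempty`
conjunct of the Statement — applies to the restricted representation `ρ₀|Γ_F = ρ₀.restrictField F`, because the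
family's de Rham clause is stated against the PINNED Fontaine datum `fontainePstAdicCompletion w ℓ hw`, which is
`Rec.pst ℓ w hw` by definition (`ReciprocityData.pst`), so the family's hypotheses give `IsGeometricFramed Rec (ρ₀|Γ_F)`
on the nose, and `Corresponds Rec ι π ρ` contains `SatakeFrobCompatibleAE ι π ρ` as its first conjunct.
Sorry-free; imports only the Statement and `IsAutomorphicAE`.  The rung is a CONSEQUENCE of `S` — fine BECAUSE the
F3 witness (`_special`: `floor_two` from the in-tree named fact `Dieulefait2015_baseChange_GL2`) pins the other end of
the ladder to a proved floor (the [nec]-trap guard of lens 3.10 is discharged by the witness).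
-/

noncomputable section

set_option linter.dupNamespace false

open scoped MatrixGroups Matrix NumberField Classical Polynomial
open Filter IsDedekindDomain Field Polynomial NumberField
open Literature.NumberTheory.Automorphic Literature.NumberTheory.GaloisRepresentations
open Literature.NumberTheory.PAdicHodge
open Summit.Langlands

namespace Summit.Langlands.Langlands.Cruxes.ReciprocityUpToIrreducibility.NonsolvableBaseChangeGL3

/-- **The RUNG FAMILY, dial = rank `n`**: non-solvable base change for `GL_n` from `ℚ` (a number field `F₀` of
degree one) to totally real fields — for every cuspidal `π₀` of `GL_n(𝔸_{F₀})` with a REGULAR `L`-algebraic infinity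
type, every `ι`, every framed `ρ₀ : Γ_{F₀} → GL_n(ℚ̄_ℓ)` attached to `π₀` at almost all places and every totally real
`F` (any `F₀`-algebra structure; no solvability, `F/ℚ` need not be Galois): if `ρ₀|Γ_F` is irreducible, a.e.
unramified and de Rham above `ℓ` for Fontaine's pinned datum, it is automorphic (`IsAutomorphicAE`). -/
def NonsolvableBaseChangeRank (n : ℕ) : Prop :=
  ∀ (F₀ : Type) [Field F₀] [NumberField F₀], Module.finrank ℚ F₀ = 1 →
    ∀ (hcpt₀ : isCompact_glFiniteIntegralLevel n F₀) (π₀ : CuspidalAutomorphicRepData n F₀ hcpt₀),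
      (∃ T : InfinityType F₀ n, π₀.1.HasInfinityType T ∧ T.IsRegular ∧ T.IsLAlgebraic) →
      ∀ (ℓ : ℕ) [Fact ℓ.Prime] (ι : PadicAlgCl ℓ ≃+* ℂ) (ρ₀ : FramedGaloisRep F₀ (PadicAlgCl ℓ) n),
        SatakeFrobCompatibleAE ι π₀.1 ρ₀ →
        ∀ (F : Type) [Field F] [NumberField F] [Algebra F₀ F] [IsTotallyReal F],
          (ρ₀.restrictField F).toGaloisRep.IsIrreducible →
          (∀ᶠ w : HeightOneSpectrum (𝓞 F) in cofinite, (ρ₀.restrictField F).IsUnramifiedAt w) →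
          (∀ (w : HeightOneSpectrum (𝓞 F)) (hw : ((ℓ : ℕ) : 𝓞 F) ∈ w.asIdeal),
              (fontainePstAdicCompletion w ℓ hw).IsDeRhamFramed ((ρ₀.restrictField F).toLocal w)) →
          ∀ (hcpt : isCompact_glFiniteIntegralLevel n F), IsAutomorphicAE ι hcpt (ρ₀.restrictField F)

/-- **THE RUNG (θ22 = 3)**: non-solvable base change for `GL₃` from `ℚ` to every totally real field. -/
def NonsolvableBaseChangeGL3 : Prop := NonsolvableBaseChangeRank 3


/-! ## F4: the rung (and every rank) is ON PATH — a consequence of the summit (sorry-free) -/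

/-- `Langlands → NonsolvableBaseChangeRank n` for every `n ≥ 1`. -/
theorem nonsolvableBaseChangeRank_of_langlands (n : ℕ) (hn : 0 < n) (hL : _root_.Langlands) :
    NonsolvableBaseChangeRank n := by
  intro F₀ _ _ _hd hcpt₀ π₀ _hreg ℓ _ ι ρ₀ _hcomp F _ _ _ _ hirr hunr hdR hcpt
  obtain ⟨⟨Rec⟩, hall⟩ := hL F
  have hB : GaloisToAutomorphic n Rec hcpt := (hall Rec n hn hcpt).2
  have hgeo : IsGeometricFramed Rec (ρ₀.restrictField F) := ⟨hunr, fun w hw => hdR w hw⟩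
  obtain ⟨π, hLalg, hcorr⟩ := hB ℓ ι (ρ₀.restrictField F) hirr hgeo
  exact ⟨π, hLalg, hcorr.1⟩

/-- **F4 on-path lemma for the rung**: `Langlands → NonsolvableBaseChangeGL3` (tagged for the judge's `aesop`). -/
@[aesop safe apply]
theorem NonsolvableBaseChangeGL3_of_Langlands (hL : _root_.Langlands) : NonsolvableBaseChangeGL3 :=
  nonsolvableBaseChangeRank_of_langlands 3 (by norm_num) hL

/-- The rank-zero member is also a consequence (vacuously irrelevant to the ladder, recorded for completeness: the
summit quantifies `0 < n`, and the family at `n = 0` is not claimed). -/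
example (hL : _root_.Langlands) : NonsolvableBaseChangeRank 1 := nonsolvableBaseChangeRank_of_langlands 1 one_pos hL

end Summit.Langlands.Langlands.Cruxes.ReciprocityUpToIrreducibility.NonsolvableBaseChangeGL3

end
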